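import Summits.Ventures.YMGap.YM3IR.BalabanSU2
import Summits.Ventures.YMGap.YM3IR.DecayTransferFree
import HarnessLib

/-!
# YM₃ infrared statement — STRENGTH AUDIT of the one conjecture `IRConjecture3` (theory-2, gen 4)

HONEST FRAMING.  Venture file of the cell `pub-ymgap` (QuantumFields programme, track Y4, seat ym3ir-theory-2).
This file proves NOTHING about Yang–Mills.  It is a planner-side AUDIT of the logical strength of the §Y4 sentence
of record `YM3IR.massGap3Cofinal_su2_balaban_of_irConjecture3` (`YM3IR/BalabanSU2.lean`): lattice statements
only, no continuum limit, no Clay-problem claim, no new physics; no axiom, no `sorry`, `0` compute.  Two findings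
are made kernel-explicit and one is TYPED (its proof is sketched in `HOME/ym3ir/AUDIT-theory2-g4.md` §2 and is a
prover/refuter item, NOT kernel-checked here):

* **(F2, PROVED) Bałaban's theorems are not consumed by the kernel arrow.**  In every `…_of_irConjecture3`
  composition the as-printed input `BalabanUV3 mk` is used only to discharge the antecedent of
  `Crossover3 mk … := BalabanUV3 mk → EntersClusterDomain …`, and `IRConjecture3` asserts that consequent outright.
  `massGap3Cofinal_of_irConjecture3_printFree` / `massGap3Cofinal_su2_of_irConjecture3_printFree` are the §Y4
  compositions WITH THE HYPOTHESIS `BalabanUV3 mk` (and the carrier `mk`) DELETED: same conclusion.  So in the sentence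
  of record print is EVIDENTIAL (CMP 102 Thm 1–2 make clause (a) of the conjecture plausible for Bałaban's own averaging
  family over its first `K` steps), not load-bearing; it becomes load-bearing only through theory-1's abstract
  `UVInterface.Ledger` / `TerminalAdapter` (a concrete terminal format), which the §Y4 sentence does not use.

* **(F1, TYPED; the witness is NOT kernel-checked) `IRConjecture3` as typed is a REFORMULATION of the target, not a
  weaker intermediate.**  The quantifier `∃ W : BlockFamily G` ranges over ALL measurable block maps.  The FOREST
  (star-decimation) family `forestFamily b` keeps the fine links `(b·y, i)`; for `2 ≤ b` the kept links are pairwise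
  disjoint 3-stars — a forest — so by the tree-gauge lemma (Montvay–Münster, *Quantum Fields on a Lattice* §3.2.5
  (3.123)–(3.133); Creutz, *Quarks, Gluons and Lattices* (9.19); in the tree: gauge invariance
  `wilsonMeasure_map_gaugeTransform_holds`) their joint law under the Wilson measure is PRODUCT HAAR, i.e. the member
  `β' = 0, W = 0` of Y2's ball (`RobustBall.zero_mem_clusterDomainFR`, `perturbedMeasure_zero_zero` below): clause (a)
  `EntersClusterDomain` holds for free (`entersClusterDomain_forestFamily`, PROVED from the named folklore fact
  `ForestMarginalHaar`), and clause (b) `FluctuationDecoupling` at block-scale rate `κ/b(β)` is — after the forest axial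
  gauge — exactly the fine theory's own exponential clustering at rate `m₀/β` with `b(β) ≍ β`.  Hence (audit claim
  `ForestWitness3`, md §2): `MassGap3Cofinal I r ρ → ∃ C_b κ > 0, IRConjecture3 B r ρ I C_b κ` for every ball containing
  `(β', W) = (0, 0)`, every continuous `ρ` and every bounded bi-invariant link weight `r`; with the print-free arrow this is
  `irConjecture3_iff_massGap3Cofinal_of_forestWitness`.  READING: the conjecture is SAFE (it cannot be false while the
  lattice mass gap along `I` is true — contrast the negatives-index lesson `not_RobustYangMillsRG`, a too-strong RG
  conjecture) and it is NOT a reduction: the §Y4 sentence certifies a DICTIONARY (the lattice mass gap on Bałaban's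
  coupling set phrased as «some block family enters Y2's certified ball with massive fluctuations»).  The (a)/(b) split is
  a research programme only for a NAMED family — Bałaban's covariant averaging followed by PINNED further averaging steps —
  which the typing `∃ W` cannot express; `CarrierFamily.FactorsThroughAveraging` (free measurable post-map after `K`
  steps) does not exclude the forest witness either (decimate the terminal field).  Repairs are theory-1 / rb-theory
  territory (pin the post-steps; or add a loop-faithfulness clause) and are recorded in the md, not attempted here.

References: T. Bałaban, CMP 102 (1985) 255–275 [cite: Balaban1985UV3]; I. Montvay, G. Münster, *Quantum Fields on a
Lattice* (CUP 1994) §3.2.5; M. Creutz, *Quarks, Gluons and Lattices* (CUP) ch. 9 eq. (9.19), ch. 17 (decimation in axial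
gauge); K. Osterwalder, E. Seiler, Ann. Phys. 110 (1978) 440 [cite: OsterwalderSeilerAnnPhys1978]; A. van Enter,
R. Fernández, A. Sokal, J. Stat. Phys. 72 (1993) 879 (decimation pathologies concern the renormalised HAMILTONIAN, not
the coarse LAW used here); cell files ym3ir/YM3-IR.md, ym3ir/YM3-IR-theory2.md §9, ym3ir/AUDIT-theory2-g4.md.
-/

noncomputable section

open MeasureTheory ProbabilityTheory
open Literature.MathematicalPhysics.QuantumLattice Literature.MathematicalPhysics.QuantumFieldTheory
open Balaban1985CMP102 Balaban1985CMP102.Setting Balaban1985CMP102.Theorems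
open Summit.QuantumFields.Balaban3D.Carriers (suGroupModel)

namespace Summit.Ventures.YMGap.YM3IR

/-! ## 1. (F2) The compositions with `BalabanUV3 mk` deleted -/

section PrintFree

variable {G : Type} [MeasurableSpace G] {N : ℕ} [Group G] [TopologicalSpace G] [IsTopologicalGroup G]
  [CompactSpace G] [BorelSpace G]

/-- `latticeMassGap3Cofinal_of` with the clause `EntersClusterDomain` supplied DIRECTLY (no `Crossover3`, no `mk`,
no `BalabanUV3`): the body of the tree proof verbatim. [folklore] -/
theorem latticeMassGap3Cofinal_of_enters {B : BallSpec G N} {r : G → G → ℝ} {ρ : G →* Matrix (Fin N) (Fin N) ℂ}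
    {I : Set ℝ} {C_b κ m_c : ℝ} (hm : 0 ≤ min m_c κ) (hr : ∃ D : ℝ, ∀ a b : G, r a b ≤ D)
    (hRB : ClusterDomainClustering B r m_c) {W : BlockFamily G} (hE : EntersClusterDomain B ρ W I C_b)
    (hFD : FluctuationDecoupling r ρ W I κ) (hDT : DecayTransfer r ρ W I m_c κ) :
    LatticeMassGap3Cofinal I r ρ (min m_c κ / (3 * C_b)) C_b := by
  refine latticeMassGap3Cofinal_of_fine (fun β hβ => (hE β hβ).1) (fun β hβ => ?_)
  obtain ⟨hb, hmem⟩ := hE β hβ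
  have hcoarse : UniformClustering r (coarseFamily ρ β W) m_c :=
    uniformClustering_coarse_of_mem hRB (fun M _ hM => hmem M hM)
  have hfine : FineUniformClustering r ρ β W (min m_c κ / (3 * W.factor β)) :=
    hDT hr β hβ hcoarse (hFD β hβ)
  refine hfine.mono ?_
  have hbpos : (0 : ℝ) < W.factor β := by exact_mod_cast W.factor_pos β
  rw [div_div]
  exact div_le_div_of_nonneg_left hm (by positivity) (by nlinarith)

/-- **(F2) `ClusterDomainClustering ∧ IRConjecture3 ⟹ MassGap3Cofinal I` — the tree's
`DecayTransferProof.massGap3Cofinal_of_irConjecture3'` WITH THE HYPOTHESIS `BalabanUV3 mk` DELETED** (and no carrier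
`mk` at all; every `ρ`, by `decayTransfer_free`).  Bałaban's theorems are not consumed by the kernel arrow of the §Y4
sentence. [folklore] -/
theorem massGap3Cofinal_of_irConjecture3_printFree {B : BallSpec G N} {r : G → G → ℝ}
    {ρ : G →* Matrix (Fin N) (Fin N) ℂ} {I : Set ℝ} {C_b κ m_c : ℝ} (hI : ¬ BddAbove I) (hC : 0 < C_b)
    (hκ : 0 < κ) (hm : 0 < m_c) (hr : ∃ D : ℝ, ∀ a b : G, r a b ≤ D) (hRB : ClusterDomainClustering B r m_c)
    (hIR : IRConjecture3 B r ρ I C_b κ) : MassGap3Cofinal I r ρ := by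
  obtain ⟨W, hE, hFD⟩ := hIR
  exact ⟨hI, min m_c κ / (3 * C_b), div_pos (lt_min hm hκ) (by positivity), C_b,
    latticeMassGap3Cofinal_of_enters (le_min hm.le hκ.le) hr hRB hE hFD DecayTransferProof.decayTransfer_free⟩

end PrintFree

/-- **(F2) The §Y4 sentence of record with `BalabanUV3 mk` DELETED (PROVED bookkeeping).**  Compare
`massGap3Cofinal_su2_balaban_of_irConjecture3` (`YM3IR/BalabanSU2.lean`): identical hypotheses and conclusion except
that the as-printed input `hUV : BalabanUV3 mk` and the implicit carrier `mk : Construction L` are absent.  What remains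
of print is the INDEX SET `balabanCouplings L (suGroupModel 2) eps0` and its unboundedness from `Nonempty (Family L eps0)`
(`CarrierBridge.not_bddAbove_balabanCouplings`). [cite: Balaban1985UV3, p.256 L15–18] -/
theorem massGap3Cofinal_su2_of_irConjecture3_printFree {L : ℕ} {eps0 : ℝ → ℝ} (hfam : Nonempty (Family L eps0))
    (r : ℕ) {C_b κ : ℝ} (hC : 0 < C_b) (hκ : 0 < κ)
    (hIR : IRConjecture3 (ballOfRobustBallFR 2 (23 / 50) (23 / 100) r (1 / 16)) suFrobDist (fundamentalRep (Fin 2))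
      (CarrierBridge.balabanCouplings L (suGroupModel 2) eps0) C_b κ) :
    MassGap3Cofinal (CarrierBridge.balabanCouplings L (suGroupModel 2) eps0) suFrobDist
      (fundamentalRep (Fin 2) : RobustBall.SUN 2 →* Matrix (Fin 2) (Fin 2) ℂ) :=
  massGap3Cofinal_of_irConjecture3_printFree (CarrierBridge.not_bddAbove_balabanCouplings (suGroupModel 2) hfam) hC hκ
    (su2_dim3_oneEighth_rate_pos' r) (suFrobDist_bddAbove 2) (RobustBall.su2_clusterDomainClustering_dim3_oneEighth r) hIR

/-! ## 2. (F1) The forest (star-decimation) block family and what it does to clause (a) -/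

section Forest

variable {G : Type} [MeasurableSpace G] {N : ℕ}

/-- The fine site `b·y` under a coarse site `y` (coordinatewise, on canonical representatives). [folklore] -/
def liftSite (b M : ℕ) (y : Site 3 M) : Site 3 (b * M) :=
  fun i => ((b * (y i).val : ℕ) : ZMod (b * M))

/-- **Star (forest) decimation**: the coarse link `(y, i)` IS the fine link `(b·y, i)`.  For `2 ≤ b` the kept fine
links are pairwise disjoint 3-stars centred at the sites `b·y` (the leaf `b·y + eᵢ` has `i`-th coordinate
`≡ 1 (mod b)`, so it is neither a centre nor a leaf of another star): a FOREST. [folklore] -/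
def starDecimation (b M : ℕ) (U : GaugeConfig 3 (b * M) G) : GaugeConfig 3 M G :=
  fun e => U (liftSite b M e.1, e.2)

omit [MeasurableSpace G] in
/-- Unfolding lemma for `starDecimation`. [folklore] -/
theorem starDecimation_apply (b M : ℕ) (U : GaugeConfig 3 (b * M) G) (e : Edge 3 M) :
    starDecimation b M U e = U (liftSite b M e.1, e.2) := rfl

/-- Star decimation is measurable (a coordinate projection). [folklore] -/
theorem measurable_starDecimation (b M : ℕ) : Measurable (starDecimation (G := G) b M) :=
  measurable_pi_lambda _ fun _ => measurable_pi_apply _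

/-- **The forest block family** with block factor `b(β)`: block map = star decimation at every coupling and side. An
admissible `BlockFamily` (measurable), translation-covariant by multiples of `b`, with gauge-INVARIANT image law — but the
MAP is NOT gauge-covariant in Bałaban's sense B7 (11) (`Balaban1983to89.Setup.Averaging.covariant`): a star link joins a
lifted site to a NON-lifted leaf (theory-1 g5; covariance of the map is what separates Bałaban's averages from the
forest) — and useless as a renormalisation group: it forgets every plaquette. [folklore] -/
def forestFamily (b : ℝ → ℕ) (hb : ∀ β, 0 < b β) : BlockFamily G where
  factor := b
  factor_pos := hb
  blk β M := starDecimation (b β) M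
  measurable_blk β M := measurable_starDecimation (b β) M

/-- The forest family's block factor is `b`. [folklore] -/
@[simp] theorem forestFamily_factor (b : ℝ → ℕ) (hb : ∀ β, 0 < b β) (β : ℝ) :
    (forestFamily (G := G) b hb).factor β = b β := rfl

variable [Group G] [TopologicalSpace G] [IsTopologicalGroup G] [CompactSpace G] [BorelSpace G]

/-- **`ForestMarginalHaar ρ b hb I` (FOLKLORE — the tree/axial gauge on a forest; NOT proved in this file: PROVED, for
`2 ≤ b β` on `I`, continuous `ρ` and second-countable `G`, in `YM3IR/ForestHaar.lean`, `forestMarginalHaar_of_two_le`):** along `I`, on every coarse torus of side `M ≥ 3`, the push-forward of the fine Wilson law under star decimation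
is PRODUCT HAAR.  In print: Montvay–Münster §3.2.5 (3.131)–(3.133) with `f ≡ 1` (the integral over the complement of a
loop-free link set `B` does not depend on the values on `B`), Creutz (9.19); mechanism in the tree: gauge invariance of
the Wilson measure (`wilsonMeasure_map_gaugeTransform_holds`) and transitivity of leaf gauge rotations on the star links.
True when `2 ≤ b β` on `I` and `ρ` is continuous; FALSE for `b β = 1` (identity map) at `β ≠ 0`. [folklore] -/
@[conjecture] def ForestMarginalHaar (ρ : G →* Matrix (Fin N) (Fin N) ℂ) (b : ℝ → ℕ) (hb : ∀ β, 0 < b β) (I : Set ℝ) : Prop :=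
  ∀ β ∈ I, ∀ (M : ℕ) [NeZero M], 3 ≤ M →
    coarseFamily ρ β (forestFamily b hb) M = Measure.pi fun _ : Edge 3 M => haarProbability G

/-- At `β' = 0`, `W = 0` the perturbed torus measure is product Haar (the Wilson weight is `e^0 = 1`, `Z = 1`). [folklore] -/
theorem perturbedMeasure_zero_zero (ρ : G →* Matrix (Fin N) (Fin N) ℂ) (M b : ℕ) [NeZero M] :
    (0 : QuasiLocalGaugePerturbation 3 M G b).perturbedMeasure ρ 0 =
      Measure.pi fun _ : Edge 3 M => haarProbability G := by
  have hw : wilsonWeight (d := 3) (L := M) ρ 0 = Measure.pi fun _ : Edge 3 M => haarProbability G := by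
    simp only [wilsonWeight, neg_zero, zero_mul, Real.exp_zero, ENNReal.ofReal_one]
    exact withDensity_one
  rw [QuasiLocalGaugePerturbation.perturbedMeasure_zero, wilsonMeasure, partitionFunction, hw, measure_univ, inv_one,
    one_smul]

/-- **Product Haar is a member of Y2's tier-1 ball** at Wilson part `β' = 0` and perturbation `W = 0` (tree:
`RobustBall.zero_mem_clusterDomainFR`), for nonnegative radii and ceiling. [folklore] -/
theorem pi_haar_mem_ballOfRobustBallFR {ε₀ ε₁ βstar : ℝ} (h₀ : 0 ≤ ε₀) (h₁ : 0 ≤ ε₁) (hβ : 0 ≤ βstar) (rFR M : ℕ)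
    [NeZero M] :
    (ballOfRobustBallFR N ε₀ ε₁ rFR βstar).Mem M (Measure.pi fun _ : Edge 3 M => haarProbability (RobustBall.SUN N)) :=
  ⟨0, le_rfl, hβ, 0, RobustBall.zero_mem_clusterDomainFR h₀ h₁ rFR,
    (perturbedMeasure_zero_zero (fundamentalRep (Fin N)) M 1).symm⟩

/-- **(F1, clause (a)) The forest family ENTERS THE CLUSTER DOMAIN for free (PROVED from the folklore marginal):** if the
star-decimated Wilson laws along `I` are product Haar and `b(β) ≤ C_b β` on `I`, then `EntersClusterDomain` holds for
the forest family on Y2's tier-1 ball — with Wilson part `β' = 0` and perturbation `W = 0`, whatever the bare `β`.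
Clause (a) of `IRConjecture3` ALONE therefore has no ultraviolet content for this family. [folklore] -/
theorem entersClusterDomain_forestFamily {ε₀ ε₁ βstar C_b : ℝ} (h₀ : 0 ≤ ε₀) (h₁ : 0 ≤ ε₁) (hβ : 0 ≤ βstar)
    (rFR : ℕ) {b : ℝ → ℕ} {hb : ∀ β, 0 < b β} {I : Set ℝ}
    (hHaar : ForestMarginalHaar (fundamentalRep (Fin N) : RobustBall.SUN N →* _) b hb I)
    (hfac : ∀ β ∈ I, (b β : ℝ) ≤ C_b * β) :
    EntersClusterDomain (ballOfRobustBallFR N ε₀ ε₁ rFR βstar) (fundamentalRep (Fin N)) (forestFamily b hb) I C_b := by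
  intro β hβI
  refine ⟨by simpa using hfac β hβI, fun M _ hM => ?_⟩
  rw [hHaar β hβI M hM]
  exact pi_haar_mem_ballOfRobustBallFR h₀ h₁ hβ rFR M

/-- **`ForestWitness3 B r ρ` (AUDIT CLAIM F1 — proof SKETCHED in ym3ir/AUDIT-theory2-g4.md §2, NOT kernel-checked; a
prover/refuter item):** the target implies the conjecture — `MassGap3Cofinal I r ρ → ∃ C_b κ > 0, IRConjecture3 B r ρ I
C_b κ` for every coupling set `I`.  Sketch: given `m₀, C_b` and the per-`β` sides `b_T(β) ≤ C_b β` of the target, take the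
forest family with `b(β) := b_T(β)·max(3, ⌈β/b_T(β)⌉)` (so `β ≤ b(β) ≤ (3C_b + 1)β`, `b_T ∣ b·M` and `3b_T ≤ b ≤ b·M`
for EVERY coarse side `M ≥ 1`, as `FluctuationDecouplingAt` quantifies; theory-1 g5 nit N-a): (a) by
`entersClusterDomain_forestFamily`; (b)(ii) exactly — `E[f | V] = Ψ_f(V)`, `Ψ_f(v) = E_{forest = 1}[f ∘ Φ_v]` with `Φ_v`
the leaf gauge rotation, local (coarse hull radius `1`) and `r`-Lipschitz with `Σδh ≤ 2Σδf` for bi-invariant `r`;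
(b)(i) — `condCov(f,g | V) = Cov_{forest=1}(f∘Φ_V, g∘Φ_V) = Cov_{Wilson}((f∘Φ_V)∘γ, (g∘Φ_V)∘γ)` with `γ(U) = U^{h_U}` the
forest axial gauge fixing (supports grow by fine distance `≤ 2`, loads `× 3`), so fine clustering at rate `m₀/β ≥ κ/b(β)`
with `κ := m₀` gives (i).  Expected hypotheses: `ρ` continuous, `r` bounded and bi-invariant, `B` contains `(0,0)`. -/
@[conjecture] def ForestWitness3 (B : BallSpec G N) (r : G → G → ℝ) (ρ : G →* Matrix (Fin N) (Fin N) ℂ) : Prop :=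
  ∀ I : Set ℝ, MassGap3Cofinal I r ρ → ∃ C_b κ : ℝ, 0 < C_b ∧ 0 < κ ∧ IRConjecture3 B r ρ I C_b κ

/-- **(F1 ∧ F2) Given the forest witness, `IRConjecture3` (with its two bookkeeping constants existentially bound) is
EQUIVALENT to the target** on every unbounded coupling set, for every ball on which Y2's clustering holds: the §Y4
sentence is then a certified dictionary, not a reduction. [folklore] -/
theorem irConjecture3_iff_massGap3Cofinal_of_forestWitness {B : BallSpec G N} {r : G → G → ℝ}
    {ρ : G →* Matrix (Fin N) (Fin N) ℂ} {I : Set ℝ} {m_c : ℝ} (hF : ForestWitness3 B r ρ) (hI : ¬ BddAbove I)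
    (hm : 0 < m_c) (hr : ∃ D : ℝ, ∀ a b : G, r a b ≤ D) (hRB : ClusterDomainClustering B r m_c) :
    (∃ C_b κ : ℝ, 0 < C_b ∧ 0 < κ ∧ IRConjecture3 B r ρ I C_b κ) ↔ MassGap3Cofinal I r ρ :=
  ⟨fun ⟨_, _, hC, hκ, h⟩ => massGap3Cofinal_of_irConjecture3_printFree hI hC hκ hm hr hRB h, hF I⟩

/-- **The `SU(2)` instance on Y2's certified row** (ball `ClusterDomainFR (23/50) (23/100) r`, ceiling `1/16`; Y2's
clustering is the tree THEOREM `RobustBall.su2_clusterDomainClustering_dim3_oneEighth`): given the forest witness for this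
ball, `(∃ C_b κ > 0, IRConjecture3 …) ↔ MassGap3Cofinal I …` for EVERY unbounded `I` — in particular Bałaban's
`balabanCouplings L (suGroupModel 2) eps0`. [folklore] -/
theorem su2_irConjecture3_iff_massGap3Cofinal_of_forestWitness (rFR : ℕ) {I : Set ℝ} (hI : ¬ BddAbove I)
    (hF : ForestWitness3 (ballOfRobustBallFR 2 (23 / 50) (23 / 100) rFR (1 / 16)) suFrobDist
      (fundamentalRep (Fin 2) : RobustBall.SUN 2 →* _)) :
    (∃ C_b κ : ℝ, 0 < C_b ∧ 0 < κ ∧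
        IRConjecture3 (ballOfRobustBallFR 2 (23 / 50) (23 / 100) rFR (1 / 16)) suFrobDist (fundamentalRep (Fin 2)) I C_b κ)
      ↔ MassGap3Cofinal I suFrobDist (fundamentalRep (Fin 2) : RobustBall.SUN 2 →* Matrix (Fin 2) (Fin 2) ℂ) :=
  irConjecture3_iff_massGap3Cofinal_of_forestWitness hF hI (su2_dim3_oneEighth_rate_pos' rFR) (suFrobDist_bddAbove 2)
    (RobustBall.su2_clusterDomainClustering_dim3_oneEighth rFR)

end Forest

end Summit.Ventures.YMGap.YM3IR

end
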